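import Mathlib
import Summits.ValiantsHypothesis.ValiantsHypothesis.Theses.RefutationDegree
import Literature.Computability.AlgebraicComplexity.DeterminantalComplexity
import Literature.Computability.AlgebraicComplexity.StandardFamilies
import Literature.Computability.AlgebraicComplexity.HessianAtOrigin
import Literature.Computability.AlgebraicComplexity.MignonRessayreBound
import Literature.Computability.AlgebraicComplexity.LRPencilOfMatrix
import Literature.Computability.AlgebraicComplexity.LandsbergRessayreNormalForm
import Literature.Computability.AlgebraicComplexity.AlperBogartVelascoSubspace
import Literature.Computability.AlgebraicComplexity.OrbitClosureProofs
import Summits.ValiantsHypothesis.ValiantsHypothesis.Theorems.RefutationDegreeBeyondHessianNsKernelPlane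
import Summits.ValiantsHypothesis.ValiantsHypothesis.Theorems.RefutationDegreeBeyondHessianNsStubAdjugateRowCol
import Summits.ValiantsHypothesis.ValiantsHypothesis.Theorems.RefutationDegreeBeyondHessianNsStubRenamePerPoly

/-!
# The Fano transfer: `dc(per_n) ≥ n² + 1 - 𝔣(y₀)` (line `Sketch`, crux `BeyondHessianNs`, stmt-ValiantsHypothesis-5641)

`𝔣(y₀)` = the largest dimension of a LINEAR subspace of the permanental hypersurface `{per_n = 0}`
through the Mignon–Ressayre point `y₀`.  The kernel-plane lemma (`…KernelPlane.lean`, cards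
`kernel-plane-jet-incidence` / `fano-span-ns`) gives `dc(per_n) ≥ n² - 𝔣(y₀)`.  This file adds ONE:

**Theorem** (`sq_add_one_le_add_of_forall_finrank_le`, registered stub `stub_fanoTransfer`): if `per_n = det A`
with `A` affine of size `N` (`n ≥ 3`, characteristic `0`) and every linear subspace `W ∋ y₀` of `{per_n = 0}` has
`dim W ≤ d`, then `n² + 1 ≤ N + d`.

Consequence for the crux: the infeasibility half of `BeyondHessianNs` at EVEN `n` (no expression of size
`n²/2 + 1`) follows from `𝔣(y₀) ≤ n²/2 - 1` — one less than what the Hessian gives (`n²/2`) and one MORE room than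
the cards' `FanoStep` (`≤ n²/2 - 2`); numerically `𝔣(y₀) = 2n - 2` (kit jobs of the ideators, n = 4: 6 ≤ 7).
-/

noncomputable section

-- `Summit.ValiantsHypothesis.ValiantsHypothesis.…` is the tree's mandated single-conjunct layout.
set_option linter.dupNamespace false

namespace Summit.ValiantsHypothesis.ValiantsHypothesis.Theorems.RefutationDegreeBeyondHessianNs

open MvPolynomial Matrix
open Literature.Computability.AlgebraicComplexity

section General

variable {K : Type*} [Field K] {σ : Type*} [Fintype σ]

/-- **Kernel plane through a kernel vector the constant term does not kill** (the `+1` over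
`exists_submodule_of_isAffineDetRepr`): if `A(y) u = 0` and `A(0) u ≠ 0` then `W = K y + {z | A_lin(z) u = 0}`
lies in `{f = 0}` and has `#σ + 1 ≤ dim W + N` (`A_lin(y) u = -A(0) u ≠ 0`, so `y` is a new direction).
[folklore] -/
theorem exists_submodule_succ_of_constPart_mulVec_ne [Infinite K] {f : MvPolynomial σ K} {d N : ℕ}
    (hf : f.IsHomogeneous d) {A : Matrix (Fin N) (Fin N) (MvPolynomial σ K)}
    (hA : IsAffineDetRepr f A) (y : σ → K) (u : Fin N → K)
    (hu : A.map (eval y) *ᵥ u = 0) (hu0 : constPart A *ᵥ u ≠ 0) :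
    ∃ W : Submodule K (σ → K), y ∈ W ∧ Fintype.card σ + 1 ≤ Module.finrank K W + N ∧
      ∀ w ∈ W, eval w f = 0 := by
  classical
  obtain ⟨hdeg, hdet⟩ := hA
  have heval : ∀ x : σ → K, eval x f = (A.map (eval x)).det := fun x => by
    rw [← hdet, RingHom.map_det, RingHom.mapMatrix_apply]
  have hune : u ≠ 0 := by
    rintro rfl
    exact hu0 (Matrix.mulVec_zero _)
  set Φ : (σ → K) →ₗ[K] (Fin N → K) :=
    Matrix.mulVecLin (Matrix.of fun i w => (LRPencil.coeffMat A w *ᵥ u) i) with hΦ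
  have hΦapply : ∀ x, Φ x = (Matrix.of fun i w => (LRPencil.coeffMat A w *ᵥ u) i) *ᵥ x :=
    fun x => rfl
  have hΦy : Φ y ≠ 0 := by
    intro h0
    have hy' := map_eval_mulVec_eq A hdeg u y
    rw [hu, ← hΦapply, h0, add_zero] at hy'
    exact hu0 hy'.symm
  have hker : ∀ x : σ → K, Φ (x - y) = 0 → eval x f = 0 := by
    intro x hx
    have h1 : A.map (eval x) *ᵥ u = 0 := by
      have hy' := map_eval_mulVec_eq A hdeg u y
      rw [hu, ← hΦapply] at hy'
      rw [map_eval_mulVec_eq A hdeg u x, ← hΦapply, map_sub, sub_eq_zero] at *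
      rw [hx, ← hy']
    rw [heval]
    exact Matrix.exists_mulVec_eq_zero_iff.mp ⟨u, hune, h1⟩
  refine ⟨(K ∙ y) ⊔ LinearMap.ker Φ, Submodule.mem_sup_left (Submodule.mem_span_singleton_self y),
    ?_, ?_⟩
  · -- dimension count: `dim W = 1 + null Φ ≥ 1 + #σ - N`
    have h1 := LinearMap.finrank_range_add_finrank_ker Φ
    have h2 : Module.finrank K (LinearMap.range Φ) ≤ N := by
      calc Module.finrank K (LinearMap.range Φ) ≤ Module.finrank K (Fin N → K) :=
            Submodule.finrank_le _
        _ = N := by simp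
    have hinf : (K ∙ y) ⊓ LinearMap.ker Φ = ⊥ := by
      rw [Submodule.eq_bot_iff]
      intro v hv
      obtain ⟨hv1, hv2⟩ := Submodule.mem_inf.mp hv
      obtain ⟨a, rfl⟩ := Submodule.mem_span_singleton.mp hv1
      rw [LinearMap.mem_ker, map_smul, smul_eq_zero] at hv2
      rcases hv2 with ha | hΦ0
      · rw [ha, zero_smul]
      · exact absurd hΦ0 hΦy
    have h3 := Submodule.finrank_sup_add_finrank_inf_eq (K ∙ y) (LinearMap.ker Φ)
    rw [hinf, finrank_bot, add_zero, finrank_span_singleton (fun h => hΦy (by rw [h, map_zero]))]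
      at h3
    have h4 : Module.finrank K (σ → K) = Fintype.card σ := by simp
    omega
  · -- zeros: `w = a • y + z` with `z ∈ ker Φ`
    intro w hw
    obtain ⟨y', hy', z, hz, rfl⟩ := Submodule.mem_sup.mp hw
    obtain ⟨a, rfl⟩ := Submodule.mem_span_singleton.mp hy'
    rw [LinearMap.mem_ker] at hz
    have hne : ∀ a : K, a ≠ 0 → eval (a • y + z) f = 0 := by
      intro a ha
      have hx : a • y + z = a • (y + a⁻¹ • z) := by
        rw [smul_add, smul_smul, mul_inv_cancel₀ ha, one_smul]
      rw [hx, eval_smul_of_isHomogeneous hf, hker, mul_zero]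
      rw [add_sub_cancel_left, map_smul, hz, smul_zero]
    by_cases ha : a = 0
    · subst ha
      set G := aeval (fun e => Polynomial.C (y e) * Polynomial.X + Polynomial.C (z e)) f with hG
      have hG0 : G = 0 := by
        apply Polynomial.eq_zero_of_infinite_isRoot
        refine Set.Infinite.mono (s := {t : K | t ≠ 0}) ?_ ?_
        · intro t ht
          simp only [Set.mem_setOf_eq, Polynomial.IsRoot.def]
          rw [hG, eval_aeval_line, hne t ht]
        · have : ({t : K | t ≠ 0}) = ({0} : Set K)ᶜ := by ext; simp
          rw [this]
          exact (Set.finite_singleton (0 : K)).infinite_compl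
      have := eval_aeval_line f y z 0
      rw [← hG, hG0, Polynomial.eval_zero] at this
      rw [← this]
    · exact hne a ha

end General

section Perm

variable {K : Type*} [Field K] [CharZero K]

/-- **The averaging lemma** (extracted from the odd-`n` theorem): for `per_n = det A` (`n = m + 3`) some
permuted expression `A ∘ π_{ij}` has `A₀ · adj A(y₀ ∘ π_{ij}) ≠ 0`; otherwise `A(y^{ij}) v₀ = 0` for the kernel
vector `v₀` of `A₀` and all `n²` translates `y^{ij} = J - n E_{ij}` of `y₀`, which average to `J`, and
`per_n(J) = n! ≠ 0`. -/
theorem exists_constPart_mul_adjugate_perm_ne {m N : ℕ}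
    (A : Matrix (Fin N) (Fin N) (MvPolynomial (Fin (m + 3) × Fin (m + 3)) K))
    (hA : IsAffineDetRepr (perPoly (Fin (m + 3)) K) A) :
    ∃ i j : Fin (m + 3), constPart A *
      (A.map (eval (mrPoint K m ∘ fun e : Fin (m + 3) × Fin (m + 3) =>
        (Equiv.swap 0 i e.1, Equiv.swap 0 j e.2)))).adjugate ≠ 0 := by
  classical
  obtain ⟨hdeg, hdet⟩ := hA
  by_contra hcon
  push Not at hcon
  have hN : 0 < N := by
    rcases Nat.eq_zero_or_pos N with rfl | h
    · exfalso
      have h0 := constantCoeff_perPoly K (show 1 ≤ m + 3 by omega)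
      rw [← hdet, Matrix.det_isEmpty, map_one] at h0
      exact one_ne_zero h0
    · exact h
  let π : Fin (m + 3) → Fin (m + 3) → (Fin (m + 3) × Fin (m + 3)) → (Fin (m + 3) × Fin (m + 3)) :=
    fun i j e => (Equiv.swap 0 i e.1, Equiv.swap 0 j e.2)
  have hfail : ∀ i j, constPart A * (A.map (eval (mrPoint K m ∘ π i j))).adjugate = 0 :=
    fun i j => hcon i j
  have hA₀det : (constPart A).det = 0 := by
    rw [det_constPart, hdet, constantCoeff_perPoly K (by omega)]
  have hA₀rank : (constPart A).rank = N - 1 := by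
    have hge := AlperBogartVelasco.le_rank_map_eval_add_one (two_ne_zero : (2 : K) ≠ 0)
      (by omega : 3 ≤ m + 3) A hdet 0
    rw [← constPart_eq_map_eval_zero] at hge
    have hlt' := Matrix.rank_lt_card_of_det_eq_zero hA₀det
    rw [Fintype.card_fin] at hlt'
    omega
  obtain ⟨v₀, hv₀, hAv₀⟩ := Matrix.exists_mulVec_eq_zero_iff.mpr hA₀det
  have huniq : ∀ u, constPart A *ᵥ u = 0 → ∃ μ : K, μ • v₀ = u := by
    have hker : Module.finrank K (LinearMap.ker (constPart A).mulVecLin) = 1 := by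
      have h1 := LinearMap.finrank_range_add_finrank_ker (constPart A).mulVecLin
      have h2 : Module.finrank K (LinearMap.range (constPart A).mulVecLin) = (constPart A).rank :=
        rfl
      rw [h2, hA₀rank] at h1
      simp only [Module.finrank_fintype_fun_eq_card, Fintype.card_fin] at h1
      omega
    have hv₀mem : v₀ ∈ LinearMap.ker (constPart A).mulVecLin := hAv₀
    have hne : (⟨v₀, hv₀mem⟩ : LinearMap.ker (constPart A).mulVecLin) ≠ 0 := by
      intro h
      exact hv₀ (congrArg Subtype.val h)
    intro u hu
    obtain ⟨μ, hμ⟩ := (finrank_eq_one_iff_of_nonzero' _ hne).mp hker ⟨u, hu⟩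
    exact ⟨μ, congrArg Subtype.val hμ⟩
  have hyv : ∀ i j, A.map (eval (mrPoint K m ∘ π i j)) *ᵥ v₀ = 0 := by
    intro i j
    have h2 := hfail i j
    have hMydet : (A.map (eval (mrPoint K m ∘ π i j))).det = 0 := by
      rw [← RingHom.mapMatrix_apply, ← RingHom.map_det, hdet, ← eval_rename,
        stub_rename_perPoly, eval_mrPoint_perPoly]
    have hMyrank : (A.map (eval (mrPoint K m ∘ π i j))).rank = Fintype.card (Fin N) - 1 := by
      have hge := AlperBogartVelasco.le_rank_map_eval_add_one (two_ne_zero : (2 : K) ≠ 0)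
        (by omega : 3 ≤ m + 3) A hdet (mrPoint K m ∘ π i j)
      have hlt' := Matrix.rank_lt_card_of_det_eq_zero hMydet
      rw [Fintype.card_fin] at hlt' ⊢
      omega
    obtain ⟨V, U, i₀, hV, hU, hVMU⟩ := exists_mul_mul_eq_lamMatrix _ hMyrank
      (by rw [Fintype.card_fin]; exact hN)
    obtain ⟨hadj, -, -⟩ := stub_adjugate_row_col _ (constPart A) V U i₀ hV hU hVMU
    obtain ⟨p, q, hpq⟩ : ∃ p q, (A.map (eval (mrPoint K m ∘ π i j))).adjugate p q ≠ 0 := by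
      by_contra h
      push Not at h
      exact hadj (Matrix.ext fun p q => by rw [h p q, Matrix.zero_apply])
    set w : Fin N → K := fun a => (A.map (eval (mrPoint K m ∘ π i j))).adjugate a q with hw
    have hA₀w : constPart A *ᵥ w = 0 := by
      funext a
      have := congrFun (congrFun h2 a) q
      rw [Matrix.mul_apply, Matrix.zero_apply] at this
      simpa [Matrix.mulVec, dotProduct, hw] using this
    obtain ⟨μ, hμ⟩ := huniq w hA₀w
    have hμ0 : μ ≠ 0 := by
      rintro rfl
      apply hpq
      have := congrFun hμ p
      simp only [zero_smul, Pi.zero_apply] at this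
      rw [hw] at this
      exact this.symm
    have hMyw : A.map (eval (mrPoint K m ∘ π i j)) *ᵥ w = 0 := by
      funext a
      have := congrFun (congrFun (Matrix.mul_adjugate (A.map (eval (mrPoint K m ∘ π i j)))) a) q
      rw [hMydet, zero_smul, Matrix.mul_apply, Matrix.zero_apply] at this
      simpa [Matrix.mulVec, dotProduct, hw] using this
    rw [← hμ, Matrix.mulVec_smul] at hMyw
    exact (smul_eq_zero.mp hMyw).resolve_left hμ0
  set Bm : Matrix (Fin N) (Fin (m + 3) × Fin (m + 3)) K :=
    Matrix.of fun a w => (LRPencil.coeffMat A w *ᵥ v₀) a with hBm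
  have hAy : ∀ y, A.map (eval y) *ᵥ v₀ = Bm *ᵥ y := by
    intro y
    rw [LRPencil.map_eval_eq A hdeg y, Matrix.add_mulVec, hAv₀, zero_add, sum_smul_mulVec_eq]
  have hsum : ∑ i : Fin (m + 3), ∑ j : Fin (m + 3), (mrPoint K m ∘ π i j) =
      ((((m + 3 : ℕ) : K)) * (((m + 3 : ℕ) : K) - 1)) • (fun _ => (1 : K)) := by
    funext e
    simp only [Finset.sum_apply, Function.comp_apply, mrPoint_apply, Pi.smul_apply, smul_eq_mul,
      mul_one, π]
    have hite : ∀ i j : Fin (m + 3),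
        (if Equiv.swap 0 i e.1 = 0 ∧ Equiv.swap 0 j e.2 = 0 then -((m : K) + 2) else 1) =
          1 + (if i = e.1 then (if j = e.2 then (-((m : K) + 2) - 1) else 0) else 0) := by
      intro i j
      have h1 : Equiv.swap 0 i e.1 = 0 ↔ e.1 = i := by
        rw [Equiv.swap_apply_eq_iff, Equiv.swap_apply_left]
      have h2 : Equiv.swap 0 j e.2 = 0 ↔ e.2 = j := by
        rw [Equiv.swap_apply_eq_iff, Equiv.swap_apply_left]
      simp only [h1, h2]
      by_cases hi : i = e.1
      · by_cases hj : j = e.2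
        · simp only [hi, hj, and_self, if_true]
          ring
        · have hj' : ¬ e.2 = j := fun h => hj h.symm
          simp [hi, hj, hj']
      · have hi' : ¬ e.1 = i := fun h => hi h.symm
        simp [hi, hi']
    simp_rw [hite]
    have inner : ∀ i : Fin (m + 3), ∑ j : Fin (m + 3),
        (1 + (if i = e.1 then (if j = e.2 then (-((m : K) + 2) - 1) else 0) else 0)) =
          ((m + 3 : ℕ) : K) + (if i = e.1 then (-((m : K) + 2) - 1) else 0) := by
      intro i
      rw [Finset.sum_add_distrib, Finset.sum_const, Finset.card_univ, Fintype.card_fin,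
        nsmul_eq_mul, mul_one]
      congr 1
      split_ifs with hi
      · rw [Finset.sum_ite_eq' Finset.univ e.2, if_pos (Finset.mem_univ _)]
      · simp
    simp_rw [inner]
    rw [Finset.sum_add_distrib, Finset.sum_const, Finset.card_univ, Fintype.card_fin,
      nsmul_eq_mul, Finset.sum_ite_eq' Finset.univ e.1, if_pos (Finset.mem_univ _)]
    push_cast
    ring
  have hJ : Bm *ᵥ (fun _ => (1 : K)) = 0 := by
    have hne : (((m + 3 : ℕ) : K)) * (((m + 3 : ℕ) : K) - 1) ≠ 0 := by
      refine mul_ne_zero (by exact_mod_cast Nat.succ_ne_zero (m + 2)) ?_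
      have : (((m + 3 : ℕ) : K) - 1) = ((m + 2 : ℕ) : K) := by push_cast; ring
      rw [this]
      exact_mod_cast Nat.succ_ne_zero (m + 1)
    have h0 : Bm *ᵥ (∑ i : Fin (m + 3), ∑ j : Fin (m + 3), (mrPoint K m ∘ π i j)) = 0 := by
      rw [Matrix.mulVec_sum]
      refine Finset.sum_eq_zero fun i _ => ?_
      rw [Matrix.mulVec_sum]
      refine Finset.sum_eq_zero fun j _ => ?_
      rw [← hAy]
      exact hyv i j
    rw [hsum, Matrix.mulVec_smul] at h0
    exact (smul_eq_zero.mp h0).resolve_left hne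
  have hdetJ : (A.map (eval (fun _ => (1 : K)))).det = 0 :=
    Matrix.exists_mulVec_eq_zero_iff.mp ⟨v₀, hv₀, by rw [hAy]; exact hJ⟩
  have hperJ : eval (fun _ => (1 : K)) (perPoly (Fin (m + 3)) K) = ((m + 3).factorial : K) := by
    simp [perPoly, Matrix.permanent, Matrix.mvPolynomialX, Fintype.card_perm]
  rw [← RingHom.mapMatrix_apply, ← RingHom.map_det, hdet, hperJ] at hdetJ
  exact Nat.factorial_ne_zero (m + 3) (by exact_mod_cast hdetJ)

end Perm

section Fano

variable {K : Type*} [Field K] [CharZero K]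

/-- **Fano transfer** `dc(per_n) ≥ n² + 1 - 𝔣(y₀)`: if every linear subspace of `{per_n = 0}` through the
Mignon–Ressayre point has dimension `≤ d`, then every affine determinantal expression of `per_n`
(`n = m + 3`) of size `N` has `n² + 1 ≤ N + d`. -/
theorem sq_add_one_le_add_of_forall_finrank_le {m N d : ℕ}
    (A : Matrix (Fin N) (Fin N) (MvPolynomial (Fin (m + 3) × Fin (m + 3)) K))
    (hA : IsAffineDetRepr (perPoly (Fin (m + 3)) K) A)
    (hd : ∀ W : Submodule K (Fin (m + 3) × Fin (m + 3) → K), mrPoint K m ∈ W →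
      (∀ w ∈ W, eval w (perPoly (Fin (m + 3)) K) = 0) → Module.finrank K W ≤ d) :
    (m + 3) ^ 2 + 1 ≤ N + d := by
  classical
  obtain ⟨i, j, hB⟩ := exists_constPart_mul_adjugate_perm_ne A hA
  obtain ⟨hdeg, hdet⟩ := hA
  set π : (Fin (m + 3) × Fin (m + 3)) → (Fin (m + 3) × Fin (m + 3)) :=
    fun e => (Equiv.swap 0 i e.1, Equiv.swap 0 j e.2) with hπ
  set A' := A.map (rename π) with hA'
  have hperm : IsAffineDetRepr (perPoly (Fin (m + 3)) K) A' := by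
    refine ⟨fun a b => ?_, ?_⟩
    · rw [hA', Matrix.map_apply]
      exact (totalDegree_rename_le _ _).trans (hdeg a b)
    · rw [hA', ← AlgHom.mapMatrix_apply, ← AlgHom.map_det, hdet]
      exact stub_rename_perPoly (Equiv.swap 0 i) (Equiv.swap 0 j)
  have hmap : A'.map (eval (mrPoint K m)) = A.map (eval (mrPoint K m ∘ π)) := by
    rw [hA', Matrix.map_map]
    congr 1
    funext p
    simp only [Function.comp_apply, eval_rename]
  have hconst : constPart A' = constPart A := by
    ext a b
    simp [hA', constPart_apply, constantCoeff_rename]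
  rw [← hmap, ← hconst] at hB
  obtain ⟨p, q, hpq⟩ : ∃ p q, (constPart A' * (A'.map (eval (mrPoint K m))).adjugate) p q ≠ 0 := by
    by_contra h
    push Not at h
    exact hB (Matrix.ext fun p q => by rw [h p q, Matrix.zero_apply])
  set u : Fin N → K := fun a => (A'.map (eval (mrPoint K m))).adjugate a q with hudef
  have hu0 : constPart A' *ᵥ u ≠ 0 := by
    intro h0
    apply hpq
    have := congrFun h0 p
    rw [Matrix.mul_apply]
    simpa [Matrix.mulVec, dotProduct, hudef] using this
  have hdet' : (A'.map (eval (mrPoint K m))).det = 0 := by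
    rw [← RingHom.mapMatrix_apply, ← RingHom.map_det, hperm.2, eval_mrPoint_perPoly]
  have hu : A'.map (eval (mrPoint K m)) *ᵥ u = 0 := by
    funext a
    have := congrFun (congrFun (Matrix.mul_adjugate (A'.map (eval (mrPoint K m)))) a) q
    rw [hdet', zero_smul, Matrix.mul_apply, Matrix.zero_apply] at this
    simpa [Matrix.mulVec, dotProduct, hudef] using this
  have hhom : (perPoly (Fin (m + 3)) K).IsHomogeneous (m + 3) := by
    simpa [Fintype.card_fin] using (perPoly_isHomogeneous (n := Fin (m + 3)) (k := K))
  obtain ⟨W, hyW, hcard, hzero⟩ :=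
    exists_submodule_succ_of_constPart_mulVec_ne hhom hperm (mrPoint K m) u hu hu0
  have := hd W hyW hzero
  rw [Fintype.card_prod, Fintype.card_fin] at hcard
  have hsq : (m + 3) ^ 2 = (m + 3) * (m + 3) := sq _
  omega

/-- **Even-`n` reduction**: if, for all large even `n`, no linear subspace of `{per_n = 0}` through `y₀` has
dimension `n²/2` (i.e. all have `dim ≤ n²/2 - 1`), then `per_n` has no affine determinantal expression of
size `n²/2 + 1` for all large even `n` — the EVEN half of the crux's infeasibility content
(`stub_evenInfeasible` of the skeleton) from a Fano-type bound one weaker than the Hessian's reach. -/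
theorem evenInfeasible_of_fanoBound
    (h : ∃ n₀ : ℕ, ∀ m : ℕ, n₀ ≤ m + 3 → Even (m + 3) →
      ∀ W : Submodule ℂ (Fin (m + 3) × Fin (m + 3) → ℂ), mrPoint ℂ m ∈ W →
        (∀ w ∈ W, eval w (perPoly (Fin (m + 3)) ℂ) = 0) →
          Module.finrank ℂ W + 1 ≤ (m + 3) ^ 2 / 2) :
    ∃ n₀ : ℕ, ∀ n ≥ n₀, Even n → ¬ HasDetRepr (perPoly (Fin n) ℂ) (n ^ 2 / 2 + 1) := by
  obtain ⟨n₀, h₀⟩ := h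
  refine ⟨max n₀ 3, fun n hn he hrep => ?_⟩
  obtain ⟨m, rfl⟩ : ∃ m, n = m + 3 := ⟨n - 3, by omega⟩
  obtain ⟨A, hA⟩ := hrep
  have key := sq_add_one_le_add_of_forall_finrank_le (d := (m + 3) ^ 2 / 2 - 1) A hA (by
    intro W hW hz
    have := h₀ m (le_of_max_le_left hn) he W hW hz
    obtain ⟨X, hX⟩ : ∃ X, (m + 3) ^ 2 = X := ⟨_, rfl⟩
    rw [hX] at this ⊢
    omega)
  have hev : Even ((m + 3) ^ 2) := Nat.even_pow.mpr ⟨he, by norm_num⟩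
  have h2 := Nat.two_mul_div_two_of_even hev
  have h9 : 3 ^ 2 ≤ (m + 3) ^ 2 := Nat.pow_le_pow_left (by omega) 2
  obtain ⟨X, hX⟩ : ∃ X, (m + 3) ^ 2 = X := ⟨_, rfl⟩
  rw [hX] at key h2 h9
  omega

/-- **The registered stub `stub_fanoTransfer`**: the Fano transfer over `ℂ`, as registered on the crux item. -/
theorem stub_fanoTransfer : ∀ (m N d : ℕ)
    (A : Matrix (Fin N) (Fin N) (MvPolynomial (Fin (m + 3) × Fin (m + 3)) ℂ)),
    Literature.Computability.AlgebraicComplexity.IsAffineDetRepr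
        (Literature.Computability.AlgebraicComplexity.perPoly (Fin (m + 3)) ℂ) A →
      (∀ W : Submodule ℂ (Fin (m + 3) × Fin (m + 3) → ℂ),
        Literature.Computability.AlgebraicComplexity.mrPoint ℂ m ∈ W →
          (∀ w ∈ W, MvPolynomial.eval w
            (Literature.Computability.AlgebraicComplexity.perPoly (Fin (m + 3)) ℂ) = 0) →
            Module.finrank ℂ W ≤ d) →
        (m + 3) ^ 2 + 1 ≤ N + d :=
  fun _ _ _ A hA hd => sq_add_one_le_add_of_forall_finrank_le A hA hd

end Fano

end Summit.ValiantsHypothesis.ValiantsHypothesis.Theorems.RefutationDegreeBeyondHessianNs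

end
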